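import Summits.CriticalPhenomena.CardyFormulaZ2.Theorems.CardyComplexConeEdgePrecompactUFRSHalfPlaneArms

/-!
# HT-B from the loose two-arm bound: an extra loose arm costs a power (Reimer + RSW)
(line `qkz-strip-boundary-arm` of crux `CardyComplexCone.EdgePrecompact`, stmt-CriticalPhenomena-11387;
support of the registered open sub-goal `hpLooseArms_three_decay` (HT-B) of the decomposition of
the bridge `ufrs_rect_flatThreeStrandDecay` (HT); worker of lead c5)

HT-B is the UNDOCKED half-plane three-arm bound
`P_{1/2}(hpLooseArms j 3 m R) ≤ C (m/n)^{1+α}` (`1 ≤ m ≤ n`, `K n ≤ R`). This file reduces it to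
the undocked half-plane TWO-arm bound (registered sub-goal `hpLooseArms_two_decay`,
`P_{1/2}(hpLooseArms j 2 m R) ≤ C m/n`: Lawler–Schramm–Werner 2002, Lemma A.1 in the "`C_r` to
`C_R`" form, the genuinely missing input — the tree's `Z2HalfPlane.real_twoArm_le` is its DOCKED
version), exactly as the tree's `Z2HalfPlane.real_threeArm_le` is derived from
`Z2HalfPlane.real_twoArm_le`:

* `hpLooseArm j m R` — ONE loose arm (open through `siteBox j R`, or dual through `faceBox j R`)
  from the window box to sup-distance `R`;
* `hpLooseArms_three_subset_disjointOccurrence` — **`3 loose arms ⊆ (2 loose arms) □ (1 loose arm)`**: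
  two arms of different colours and the third arm are disjoint witnesses (open witnesses are open
  edges, dual witnesses are crossed closed edges; same-colour witnesses are disjoint by definition
  of the event);
* `determinedBy_hpLooseArms`, `determinedBy_hpLooseArm` — both events are local;
* `real_hpLooseArm_le` — the RSW one-arm bound `C₁ (m/R)^α` (`R ≥ K₁ m`): a loose arm of either
  kind crosses the Euclidean annulus `A((j,0); 2cm, R/2)` at mesh `1`
  (`annulusOpenCrossing_half_le_holds`, `annulusDualCrossing_half_le_holds`; adapted from
  `Z2HalfPlane.annulusOpenCrossing_of_openArm` / `annulusDualCrossing_of_dualArm`);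
* `hpLooseArms_three_decay_of_two` (registered) — **HT-B from the loose two-arm bound** by
  Reimer's inequality (`reimer_holds`).

References: G. F. Lawler, O. Schramm, W. Werner, Electron. J. Probab. 7 (2002), App. A; D. Reimer,
Combin. Probab. Comput. 9 (2000); P. Nolin, Electron. J. Probab. 13 (2008), §4.1, §4.6.
-/

namespace Summit.CriticalPhenomena.CardyFormulaZ2.Cruxes.EdgePrecompact.QkzStripBoundaryArm

open MeasureTheory Filter Set Metric SimpleGraph
open scoped Topology BigOperators Pointwise
open Literature.Probability.LatticeModels Literature.Probability.Percolation
open Literature.Probability.RandomPlanarGeometry (DobrushinDomain)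
open Summit.CriticalPhenomena.CardyFormulaZ2.Theses.CardyComplexCone

noncomputable section

/-! ## One loose arm -/

/-- **One loose arm of the upper half-plane** from the window box of half-width `m` around
`(j, 0)` to sup-distance `R`: an open walk through `siteBox j R`, or a face walk through
`faceBox j R` crossing closed edges. -/
def hpLooseArm (j : ℤ) (m R : ℕ) : Set (BondConfig (Site 2)) :=
  {ω | ∃ (x y : Site 2) (W : (zdGraph 2).Walk x y), (j - m ≤ x 0 ∧ x 0 ≤ j + m ∧ x 1 ≤ m) ∧ Z2HalfPlane.Far R j y ∧
    (((∀ u ∈ W.support, u ∈ Z2HalfPlane.siteBox j R) ∧ ∀ e ∈ W.edges, e ∈ ω) ∨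
      ((∀ u ∈ W.support, u ∈ Z2HalfPlane.faceBox j R) ∧ ∀ d ∈ W.darts, sepEdge d.fst d.snd ∉ ω))}

/-! ## Three loose arms occur disjointly as two plus one -/

/-- In `Fin 3`, two distinct indices leave a third one. -/
theorem exists_third_fin3 : ∀ a b : Fin 3, a ≠ b → ∃ c : Fin 3, c ≠ a ∧ c ≠ b := by decide
/-- **`3 loose arms ⊆ (2 loose arms) □ (1 loose arm)`.** Two arms of different colours, witnessed
by their open edges / crossed closed edges, and the third arm, witnessed likewise, occur on
disjoint sets of pairs. -/
theorem hpLooseArms_three_subset_disjointOccurrence (j : ℤ) (m R : ℕ) :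
    hpLooseArms j 3 m R ⊆ hpLooseArms j 2 m R □ hpLooseArm j m R := by
  classical
  rintro ω ⟨κ, x, y, W, ⟨a, b, hab⟩, harm, hpw⟩
  have hne : a ≠ b := fun h => hab (h ▸ rfl)
  obtain ⟨c, hca, hcb⟩ := exists_third_fin3 a b hne
  set σ : Fin 2 → Fin 3 := ![a, b] with hσ
  have hσc : ∀ i, σ i ≠ c := fun i => by
    fin_cases i
    · exact fun h => hca (h ▸ rfl)
    · exact fun h => hcb (h ▸ rfl)
  have hσinj : Function.Injective σ := by
    intro i i' h
    fin_cases i <;> fin_cases i'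
    · rfl
    · exact absurd h hne
    · exact absurd h.symm hne
    · rfl
  -- witnesses of one arm
  let wit : Fin 3 → Set (Sym2 (Site 2)) := fun i =>
    {e | (κ i = true ∧ e ∈ (W i).edges) ∨ (κ i = false ∧ ∃ d ∈ (W i).darts, e = sepEdge d.fst d.snd)}
  have hwit_open : ∀ i, κ i = true → ∀ e ∈ wit i, e ∈ ω := by
    rintro i hi e (⟨-, he⟩ | ⟨hf, -⟩)
    · exact ((harm i).2.2.1 hi).2 e he
    · rw [hi] at hf; exact absurd hf (by decide)
  have hwit_closed : ∀ i, κ i = false → ∀ e ∈ wit i, e ∉ ω := by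
    rintro i hi e (⟨ht, -⟩ | ⟨-, d, hd, rfl⟩)
    · rw [hi] at ht; exact absurd ht (by decide)
    · exact ((harm i).2.2.2 hi).2 d hd
  -- witnesses of distinct arms are disjoint
  have hdis : ∀ i i', i ≠ i' → Disjoint (wit i) (wit i') := fun i i' hii' => by
    refine Set.disjoint_left.2 fun e he he' => ?_
    rcases Bool.eq_false_or_eq_true (κ i) with hi | hi <;>
      rcases Bool.eq_false_or_eq_true (κ i') with hi' | hi'
    · -- both open
      rcases he with ⟨-, he⟩ | ⟨hf, -⟩
      · rcases he' with ⟨-, he'⟩ | ⟨hf', -⟩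
        · exact ((hpw hii' (hi.trans hi'.symm)).1 hi e he) he'
        · rw [hi'] at hf'; exact absurd hf' (by decide)
      · rw [hi] at hf; exact absurd hf (by decide)
    · exact hwit_closed i' hi' e he' (hwit_open i hi e he)
    · exact hwit_closed i hi e he (hwit_open i' hi' e he')
    · -- both closed
      rcases he with ⟨ht, -⟩ | ⟨-, d, hd, rfl⟩
      · rw [hi] at ht; exact absurd ht (by decide)
      · rcases he' with ⟨ht', -⟩ | ⟨-, d', hd', hdd'⟩
        · rw [hi'] at ht'; exact absurd ht' (by decide)
        · exact (hpw hii' (hi.trans hi'.symm)).2 hi d hd d' hd' hdd'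
  refine ⟨wit (σ 0) ∪ wit (σ 1), wit c, ?_, ?_, ?_⟩
  · exact Set.disjoint_union_left.2 ⟨hdis _ _ (hσc 0), hdis _ _ (hσc 1)⟩
  · -- the cylinder of the first two arms
    intro ω' hω'
    have hag : ∀ i : Fin 2, ∀ e ∈ wit (σ i), (e ∈ ω' ↔ e ∈ ω) := fun i e he => by
      fin_cases i
      · exact hω' e (Or.inl he)
      · exact hω' e (Or.inr he)
    refine ⟨fun i => κ (σ i), fun i => x (σ i), fun i => y (σ i), fun i => W (σ i), ⟨0, 1, hab⟩,
      fun i => ⟨(harm (σ i)).1, (harm (σ i)).2.1, fun hi => ⟨((harm (σ i)).2.2.1 hi).1, fun e he => ?_⟩,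
        fun hi => ⟨((harm (σ i)).2.2.2 hi).1, fun d hd h => ?_⟩⟩, fun i i' hii' => hpw (hσinj.ne hii')⟩
    · exact (hag i e (Or.inl ⟨hi, he⟩)).2 (((harm (σ i)).2.2.1 hi).2 e he)
    · exact ((harm (σ i)).2.2.2 hi).2 d hd ((hag i _ (Or.inr ⟨hi, d, hd, rfl⟩)).1 h)
  · -- the cylinder of the third arm
    intro ω' hω'
    refine ⟨x c, y c, W c, (harm c).1, (harm c).2.1, ?_⟩
    rcases Bool.eq_false_or_eq_true (κ c) with hc | hc
    · refine Or.inl ⟨((harm c).2.2.1 hc).1, fun e he => ?_⟩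
      exact (hω' e (Or.inl ⟨hc, he⟩)).2 (((harm c).2.2.1 hc).2 e he)
    · refine Or.inr ⟨((harm c).2.2.2 hc).1, fun d hd h => ?_⟩
      exact ((harm c).2.2.2 hc).2 d hd ((hω' _ (Or.inr ⟨hc, d, hd, rfl⟩)).1 h)

/-! ## Locality -/
/-- The edges of a walk through `siteBox j R` are pairs of `armSites j 1 R`. -/
theorem edge_mem_sym2_armSites {j : ℤ} {R : ℕ} {u v : Site 2} (W : (zdGraph 2).Walk u v)
    (hW : ∀ z ∈ W.support, z ∈ Z2HalfPlane.siteBox j R) {e : Sym2 (Site 2)} (he : e ∈ W.edges) :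
    e ∈ (↑(Z2HalfPlane.armSites j 1 R).sym2 : Set (Sym2 (Site 2))) := by
  have hsub := Z2HalfPlane.siteBox_subset_armSites (j := j) (a := j) (m := 1) (R := R) le_rfl (by omega)
  induction e using Sym2.ind with
  | _ s t =>
    rw [Finset.mem_coe, Finset.mk_mem_sym2_iff]
    exact ⟨hsub (hW _ (W.fst_mem_support_of_mem_edges he)), hsub (hW _ (W.snd_mem_support_of_mem_edges he))⟩

/-- The edges crossed by a face walk through `faceBox j R` are pairs of `armSites j 1 R`. -/
theorem sepEdge_dart_mem_sym2_armSites {j : ℤ} {R : ℕ} {u v : Site 2} (W : (zdGraph 2).Walk u v)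
    (hW : ∀ z ∈ W.support, z ∈ Z2HalfPlane.faceBox j R) {d : (zdGraph 2).Dart} (hd : d ∈ W.darts) :
    sepEdge d.fst d.snd ∈ (↑(Z2HalfPlane.armSites j 1 R).sym2 : Set (Sym2 (Site 2))) :=
  Finset.mem_coe.2 (Z2HalfPlane.sepEdge_mem_sym2_armSites (j := j) (b := j) (m := 1) le_rfl (by omega)
    (hW _ (W.dart_fst_mem_support_of_mem_darts hd)) (hW _ (W.dart_snd_mem_support_of_mem_darts hd)))

/-- One direction of locality for the loose arm events. -/
theorem mem_hpLooseArms_of_inter_eq {j : ℤ} {k m R : ℕ} {ω ω' : BondConfig (Site 2)}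
    (h : ω ∩ ↑(Z2HalfPlane.armSites j 1 R).sym2 = ω' ∩ ↑(Z2HalfPlane.armSites j 1 R).sym2)
    (hω : ω ∈ hpLooseArms j k m R) : ω' ∈ hpLooseArms j k m R := by
  obtain ⟨κ, x, y, W, hne, harm, hpw⟩ := hω
  refine ⟨κ, x, y, W, hne, fun a => ⟨(harm a).1, (harm a).2.1, fun ha => ⟨((harm a).2.2.1 ha).1, fun e he => ?_⟩,
    fun ha => ⟨((harm a).2.2.2 ha).1, fun d hd hd' => ?_⟩⟩, hpw⟩
  · have hmem := edge_mem_sym2_armSites (W a) ((harm a).2.2.1 ha).1 he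
    exact ((Set.ext_iff.1 h e).1 ⟨((harm a).2.2.1 ha).2 e he, hmem⟩).1
  · have hmem := sepEdge_dart_mem_sym2_armSites (W a) ((harm a).2.2.2 ha).1 hd
    exact ((harm a).2.2.2 ha).2 d hd ((Set.ext_iff.1 h _).2 ⟨hd', hmem⟩).1

/-- **The loose arm events are local** (read off the pairs of `armSites j 1 R`). -/
theorem determinedBy_hpLooseArms (j : ℤ) (k m R : ℕ) :
    DeterminedBy (hpLooseArms j k m R) ↑(Z2HalfPlane.armSites j 1 R).sym2 := by
  rw [determinedBy_iff]
  exact fun ω ω' h => ⟨mem_hpLooseArms_of_inter_eq h, mem_hpLooseArms_of_inter_eq h.symm⟩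

/-- One direction of locality for the loose one-arm event. -/
theorem mem_hpLooseArm_of_inter_eq {j : ℤ} {m R : ℕ} {ω ω' : BondConfig (Site 2)}
    (h : ω ∩ ↑(Z2HalfPlane.armSites j 1 R).sym2 = ω' ∩ ↑(Z2HalfPlane.armSites j 1 R).sym2)
    (hω : ω ∈ hpLooseArm j m R) : ω' ∈ hpLooseArm j m R := by
  obtain ⟨x, y, W, hx, hy, harm⟩ := hω
  refine ⟨x, y, W, hx, hy, ?_⟩
  rcases harm with ⟨hS, hE⟩ | ⟨hS, hE⟩
  · refine Or.inl ⟨hS, fun e he => ?_⟩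
    exact ((Set.ext_iff.1 h e).1 ⟨hE e he, edge_mem_sym2_armSites W hS he⟩).1
  · refine Or.inr ⟨hS, fun d hd hd' => ?_⟩
    exact hE d hd ((Set.ext_iff.1 h _).2 ⟨hd', sepEdge_dart_mem_sym2_armSites W hS hd⟩).1

/-- The loose one-arm event is local. -/
theorem determinedBy_hpLooseArm (j : ℤ) (m R : ℕ) :
    DeterminedBy (hpLooseArm j m R) ↑(Z2HalfPlane.armSites j 1 R).sym2 := by
  rw [determinedBy_iff]
  exact fun ω ω' h => ⟨mem_hpLooseArm_of_inter_eq h, mem_hpLooseArm_of_inter_eq h.symm⟩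

/-! ## The one-arm bound: a loose arm crosses a Euclidean annulus around the window -/

/-- A point of the window box (`|x 0 - j| ≤ m`, `-1 ≤ x 1 ≤ m`, `m ≥ 1`) is within `√2 m` of
`(j, 0)` at mesh `1`. -/
theorem dist_window_le {j : ℤ} {m : ℕ} (hm : 1 ≤ m) {x : Site 2} (hx : j - m ≤ x 0 ∧ x 0 ≤ j + m ∧ x 1 ≤ m)
    (hx1 : -1 ≤ x 1) : dist (meshPoint 1 x) (meshPoint 1 ![j, 0]) ≤ Real.sqrt 2 * m := by
  have hm0 : (1 : ℝ) ≤ m := by exact_mod_cast hm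
  obtain ⟨h1, h2, h3⟩ := hx
  have h1' : (j : ℝ) - m ≤ x 0 := by exact_mod_cast h1
  have h2' : (x 0 : ℝ) ≤ j + m := by exact_mod_cast h2
  have h3' : (x 1 : ℝ) ≤ m := by exact_mod_cast h3
  have h4' : (-1 : ℝ) ≤ x 1 := by exact_mod_cast hx1
  refine Z2HalfPlane.dist_meshPoint_one_le fun i => ?_
  fin_cases i <;> simp <;> rw [abs_le] <;> constructor <;> linarith

/-- A `Far R j` point is at Euclidean distance `≥ R/2` (indeed `≥ R`) from `(j, 0)` at mesh `1`. -/
theorem not_lt_of_far {j : ℤ} {R : ℕ} {v : Site 2} (hv : Z2HalfPlane.Far R j v) :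
    ¬ dist (meshPoint 1 v) (meshPoint 1 ![j, 0]) < R / 2 := by
  -- adapted from `Z2HalfPlane.annulusOpenCrossing_of_openArm` (the `hend` step)
  intro hvA
  rcases hv with hfar | hfar
  · have h1 := Z2HalfPlane.abs_sub_le_dist_meshPoint_one ![j, 0] v 0
    simp only [Matrix.cons_val_zero] at h1
    have h2' : (R : ℤ) ≤ |v 0 - j| := hfar
    have h2 : ((R : ℤ) : ℝ) ≤ |(v 0 : ℝ) - j| := by exact_mod_cast h2'
    push_cast at h2
    linarith
  · have h1 := Z2HalfPlane.abs_sub_le_dist_meshPoint_one ![j, 0] v 1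
    have e1 : (((![j, 0] : Site 2) 1 : ℤ) : ℝ) = 0 := by simp
    rw [e1, sub_zero] at h1
    have h2 : ((R : ℤ) : ℝ) ≤ (v 1 : ℝ) := by exact_mod_cast hfar
    push_cast at h2
    linarith [le_abs_self ((v 1 : ℤ) : ℝ)]

/-- **A loose open arm crosses the annulus `A((j,0); r, R/2)` at mesh `1`** (`2m ≤ r`,
`4m ≤ R`; the arm is stopped at its first site at Euclidean distance `≥ R/2` from `(j,0)`). -/
theorem annulusOpenCrossing_of_looseOpenArm {ω : BondConfig (Site 2)} {j : ℤ} {m R : ℕ} (hm : 1 ≤ m)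
    (hR : 4 * m ≤ R) {r : ℝ} (hr : 2 * (m : ℝ) ≤ r) {x v : Site 2}
    (hx : j - m ≤ x 0 ∧ x 0 ≤ j + m ∧ x 1 ≤ m) (hv : Z2HalfPlane.Far R j v) (q : (zdGraph 2).Walk x v)
    (hqS : ∀ z ∈ q.support, z ∈ Z2HalfPlane.siteBox j R) (hqω : ∀ e ∈ q.edges, e ∈ ω) :
    ω ∈ annulusOpenCrossing (meshPoint 1 ![j, 0]) 1 r (R / 2) := by
  -- adapted from `Z2HalfPlane.annulusOpenCrossing_of_openArm`
  have hm0 : (1 : ℝ) ≤ m := by exact_mod_cast hm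
  have hR' : (4 : ℝ) * m ≤ R := by exact_mod_cast hR
  have hx1 : -1 ≤ x 1 := by have := (Z2HalfPlane.mem_siteBox.1 (hqS x q.start_mem_support)).2.1; omega
  have hdx := dist_window_le hm hx hx1
  set A : Set (Site 2) := {w | dist (meshPoint 1 w) (meshPoint 1 ![j, 0]) < R / 2} with hA
  have hstart : x ∈ A := by
    show dist (meshPoint 1 x) (meshPoint 1 ![j, 0]) < R / 2
    nlinarith [Z2HalfPlane.sqrt_two_lt_three_halves, Real.sqrt_nonneg 2]
  have hend : v ∉ A := not_lt_of_far hv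
  obtain ⟨x', z, q₁, hxz, hz, hqA, hsupp, hedges, hlast⟩ := exists_prefix_exit q hstart hend
  rw [mem_annulusOpenCrossing_iff]
  refine ⟨x, ?_, z, not_lt.1 hz, mem_openConnIn_of_walk (q₁.concat hxz) (fun w hw => ?_) (fun e he => ?_)⟩
  · nlinarith [Z2HalfPlane.sqrt_two_lt_three_halves, Real.sqrt_nonneg 2, hr]
  · rw [Walk.support_concat, List.mem_append, List.mem_singleton] at hw
    show dist (meshPoint 1 w) (meshPoint 1 ![j, 0]) ≤ R / 2 + 2 * 1
    rcases hw with hw | rfl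
    · exact (hqA w hw).le.trans (by linarith)
    · have h1 : dist (meshPoint 1 w) (meshPoint 1 x') ≤ Real.sqrt 2 * 1 := by
        refine Z2HalfPlane.dist_meshPoint_one_le fun i => ?_
        rcases stepKind_of_adj hxz with ⟨e0, e1⟩ | ⟨e0, e1⟩ | ⟨e1, e0⟩ | ⟨e1, e0⟩ <;> fin_cases i <;>
          simp <;> rw [abs_le] <;> constructor <;> push_cast [e0, e1] <;> linarith
      have h2 : dist (meshPoint 1 x') (meshPoint 1 ![j, 0]) < R / 2 := hqA x' q₁.end_mem_support
      linarith [dist_triangle (meshPoint 1 w) (meshPoint 1 x') (meshPoint 1 ![j, 0]),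
        Z2HalfPlane.sqrt_two_lt_three_halves]
  · rw [Walk.edges_concat, List.concat_eq_append, List.mem_append, List.mem_singleton] at he
    rcases he with he | rfl
    · exact hqω e (hedges e he)
    · exact hqω _ hlast

/-- **A loose dual arm crosses the annulus `A((j,0); r, R/2)` at mesh `1` by closed (dual-open)
edges** (`2m ≤ r`, `4m ≤ R`). -/
theorem annulusDualCrossing_of_looseDualArm {ω : BondConfig (Site 2)} {j : ℤ} {m R : ℕ} (hm : 1 ≤ m)
    (hR : 4 * m ≤ R) {r : ℝ} (hr : 2 * (m : ℝ) ≤ r) {x g : Site 2}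
    (hx : j - m ≤ x 0 ∧ x 0 ≤ j + m ∧ x 1 ≤ m) (hg : Z2HalfPlane.Far R j g) (q : (zdGraph 2).Walk x g)
    (hqS : ∀ z ∈ q.support, z ∈ Z2HalfPlane.faceBox j R) (hqω : ∀ d ∈ q.darts, sepEdge d.fst d.snd ∉ ω) :
    ω ∈ annulusDualCrossing (meshPoint 1 ![j, 0]) 1 r (R / 2) := by
  -- adapted from `Z2HalfPlane.annulusDualCrossing_of_dualArm`
  have hm0 : (1 : ℝ) ≤ m := by exact_mod_cast hm
  have hR' : (4 : ℝ) * m ≤ R := by exact_mod_cast hR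
  have hx1 : -1 ≤ x 1 := (Z2HalfPlane.mem_faceBox.1 (hqS x q.start_mem_support)).2.1
  have hdx := dist_window_le hm hx hx1
  set A : Set (Site 2) := {w | dist (meshPoint 1 w) (meshPoint 1 ![j, 0]) < R / 2} with hA
  have hstart : x ∈ A := by
    show dist (meshPoint 1 x) (meshPoint 1 ![j, 0]) < R / 2
    nlinarith [Z2HalfPlane.sqrt_two_lt_three_halves, Real.sqrt_nonneg 2]
  have hend : g ∉ A := not_lt_of_far hg
  obtain ⟨x', z, q₁, hxz, hz, hqA, hsupp, hedges, hlast⟩ := exists_prefix_exit q hstart hend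
  -- the darts of the stopped walk are darts of `q`
  have hdarts : ∀ d ∈ (q₁.concat hxz).darts, sepEdge d.fst d.snd ∉ ω := by
    intro d hd
    have hde : s(d.fst, d.snd) ∈ q.edges := by
      rw [Walk.darts_concat, List.concat_eq_append, List.mem_append, List.mem_singleton] at hd
      rcases hd with hd | rfl
      · exact hedges _ (by rw [Walk.edges]; exact List.mem_map.2 ⟨d, hd, rfl⟩)
      · exact hlast
    rw [Walk.edges, List.mem_map] at hde
    obtain ⟨d', hd', hdd'⟩ := hde
    rcases Sym2.eq_iff.1 hdd' with ⟨h1, h2⟩ | ⟨h1, h2⟩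
    · rw [← h1, ← h2]; exact hqω d' hd'
    · rw [← h1, ← h2, sepEdge_comm]; exact hqω d' hd'
  show dualConfig ω ∈ annulusOpenCrossing (meshPoint 1 ![j, 0]) 1 r (R / 2)
  rw [mem_annulusOpenCrossing_iff]
  refine ⟨x, ?_, z, not_lt.1 hz, Z2HalfPlane.dualConfig_mem_openConnIn_of_walk (q₁.concat hxz) (fun w hw => ?_) hdarts⟩
  · nlinarith [Z2HalfPlane.sqrt_two_lt_three_halves, Real.sqrt_nonneg 2, hr]
  · rw [Walk.support_concat, List.mem_append, List.mem_singleton] at hw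
    show dist (meshPoint 1 w) (meshPoint 1 ![j, 0]) ≤ R / 2 + 2 * 1
    rcases hw with hw | rfl
    · exact (hqA w hw).le.trans (by linarith)
    · have h1 : dist (meshPoint 1 w) (meshPoint 1 x') ≤ Real.sqrt 2 * 1 := by
        refine Z2HalfPlane.dist_meshPoint_one_le fun i => ?_
        rcases stepKind_of_adj hxz with ⟨e0, e1⟩ | ⟨e0, e1⟩ | ⟨e1, e0⟩ | ⟨e1, e0⟩ <;> fin_cases i <;>
          simp <;> rw [abs_le] <;> constructor <;> push_cast [e0, e1] <;> linarith
      have h2 : dist (meshPoint 1 x') (meshPoint 1 ![j, 0]) < R / 2 := hqA x' q₁.end_mem_support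
      linarith [dist_triangle (meshPoint 1 w) (meshPoint 1 x') (meshPoint 1 ![j, 0]),
        Z2HalfPlane.sqrt_two_lt_three_halves]

/-- **The loose one-arm bound** (RSW): there are `C₁`, `α > 0` and `K₁ ≥ 1` with
`P_{1/2}(hpLooseArm j m R) ≤ C₁ (m/R)^α` for all `1 ≤ m`, `K₁ m ≤ R`. -/
theorem real_hpLooseArm_le : ∃ C₁ α : ℝ, 0 < C₁ ∧ 0 < α ∧ ∃ K₁ : ℕ, 1 ≤ K₁ ∧ ∀ (j : ℤ) (m R : ℕ),
    1 ≤ m → K₁ * m ≤ R →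
      (bondPercolation (zdGraph 2) half).real (hpLooseArm j m R) ≤ C₁ * ((m : ℝ) / R) ^ α := by
  -- adapted from `Z2HalfPlane.real_oneArm_le`
  obtain ⟨α₁, c₁, hα₁, hc₁, hopen⟩ := annulusOpenCrossing_half_le_holds
  obtain ⟨α₂, c₂, hα₂, hc₂, hdual⟩ := annulusDualCrossing_half_le_holds
  set α := min α₁ α₂ with hα
  have hαpos : 0 < α := lt_min hα₁ hα₂
  set c : ℝ := max 1 (max c₁ c₂) with hc
  have hc1 : 1 ≤ c := le_max_left _ _
  have hcc₁ : c₁ ≤ c := (le_max_left _ _).trans (le_max_right _ _)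
  have hcc₂ : c₂ ≤ c := (le_max_right _ _).trans (le_max_right _ _)
  set K₁ : ℕ := ⌈8 * c⌉₊ + 4 with hK₁
  refine ⟨2 * (4 * c) ^ α, α, by positivity, hαpos, K₁, by omega, fun j m R hm hR => ?_⟩
  set μ := bondPercolation (zdGraph 2) half with hμ
  have hm0 : (1 : ℝ) ≤ m := by exact_mod_cast hm
  have hK₁' : 8 * c ≤ K₁ := by
    have : 8 * c ≤ ⌈8 * c⌉₊ := Nat.le_ceil _
    have h2 : ((⌈8 * c⌉₊ + 4 : ℕ) : ℝ) = K₁ := by rw [hK₁]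
    push_cast at h2; linarith
  have hR' : (K₁ : ℝ) * m ≤ R := by exact_mod_cast hR
  have hR4 : 4 * m ≤ R := le_trans (Nat.mul_le_mul_right m (by omega : 4 ≤ K₁)) hR
  have hRpos : (0 : ℝ) < R := by nlinarith
  set r : ℝ := 2 * c * m with hr
  have hr2m : 2 * (m : ℝ) ≤ r := by rw [hr]; nlinarith
  have hrc₁ : c₁ * 1 ≤ r := by rw [mul_one, hr]; nlinarith
  have hrc₂ : c₂ * 1 ≤ r := by rw [mul_one, hr]; nlinarith
  have hrR : 2 * r ≤ R / 2 := by rw [hr]; nlinarith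
  have hratio : r / (R / 2) = (4 * c) * (m / R) := by rw [hr]; field_simp; ring
  have hratio_nn : 0 ≤ (4 * c) * ((m : ℝ) / R) := by positivity
  have hratio_le : (4 * c) * ((m : ℝ) / R) ≤ 1 := by rw [← hratio, div_le_one (by linarith)]; nlinarith
  have hsub : hpLooseArm j m R ⊆
      annulusOpenCrossing (meshPoint 1 ![j, 0]) 1 r (R / 2) ∪ annulusDualCrossing (meshPoint 1 ![j, 0]) 1 r (R / 2) := by
    rintro ω ⟨x, y, W, hx, hy, ⟨hS, hE⟩ | ⟨hS, hE⟩⟩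
    · exact Or.inl (annulusOpenCrossing_of_looseOpenArm hm hR4 hr2m hx hy W hS hE)
    · exact Or.inr (annulusDualCrossing_of_looseDualArm hm hR4 hr2m hx hy W hS hE)
  have h1 : μ.real (annulusOpenCrossing (meshPoint 1 ![j, 0]) 1 r (R / 2)) ≤ ((4 * c) * ((m : ℝ) / R)) ^ α := by
    refine (hopen _ 1 r (R / 2) one_pos hrc₁ hrR).trans ?_
    rw [hratio]
    exact Real.rpow_le_rpow_of_exponent_ge' hratio_nn hratio_le hαpos.le (min_le_left _ _)
  have h2 : μ.real (annulusDualCrossing (meshPoint 1 ![j, 0]) 1 r (R / 2)) ≤ ((4 * c) * ((m : ℝ) / R)) ^ α := by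
    refine (hdual _ 1 r (R / 2) one_pos hrc₂ hrR).trans ?_
    rw [hratio]
    exact Real.rpow_le_rpow_of_exponent_ge' hratio_nn hratio_le hαpos.le (min_le_right _ _)
  calc μ.real (hpLooseArm j m R)
      ≤ μ.real (annulusOpenCrossing (meshPoint 1 ![j, 0]) 1 r (R / 2) ∪
          annulusDualCrossing (meshPoint 1 ![j, 0]) 1 r (R / 2)) := measureReal_mono hsub (measure_ne_top _ _)
    _ ≤ ((4 * c) * ((m : ℝ) / R)) ^ α + ((4 * c) * ((m : ℝ) / R)) ^ α :=
        (measureReal_union_le _ _).trans (add_le_add h1 h2)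
    _ = 2 * (4 * c) ^ α * ((m : ℝ) / R) ^ α := by rw [Real.mul_rpow (by positivity) (by positivity)]; ring

/-! ## HT-B from the loose two-arm bound -/

/-- **HT-B from the loose two-arm bound** (registered sub-goal
`hpLooseArms_three_decay_of_two` of stmt-CriticalPhenomena-11387): the undocked half-plane
two-arm bound `P_{1/2}(hpLooseArms j 2 m R) ≤ C m/n` (`1 ≤ m ≤ n`, `K n ≤ R`; registered open
sub-goal `hpLooseArms_two_decay`, LSW02 Lemma A.1 in the `C_r`-to-`C_R` form) implies the
undocked three-arm bound HT-B `hpLooseArms_three_decay` with an extra power `α` — by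
`3 ⊆ 2 □ 1`, Reimer's inequality and the RSW one-arm bound. -/
theorem hpLooseArms_three_decay_of_two : (∃ C : ℝ, 0 < C ∧ ∃ K : ℕ, 1 ≤ K ∧ ∀ (j : ℤ) (m n R : ℕ), 1 ≤ m → m ≤ n → K * n ≤ R → (bondPercolation (zdGraph 2) half).real (hpLooseArms j 2 m R) ≤ C * m / n) → (∃ C α : ℝ, 0 < C ∧ 0 < α ∧ ∃ K : ℕ, 1 ≤ K ∧ ∀ (j : ℤ) (m n R : ℕ), 1 ≤ m → m ≤ n → K * n ≤ R → (bondPercolation (zdGraph 2) half).real (hpLooseArms j 3 m R) ≤ C * ((m : ℝ) / n) ^ (1 + α)) := by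
  -- adapted from `Z2HalfPlane.real_threeArm_le`
  rintro ⟨C₂, hC₂, K₂, hK₂, htwo⟩
  obtain ⟨C₁, α, hC₁, hα, K₁, hK₁, hone⟩ := real_hpLooseArm_le
  refine ⟨C₂ * C₁, α, by positivity, hα, max K₂ K₁, le_trans hK₂ (le_max_left _ _),
    fun j m n R hm hmn hR => ?_⟩
  set μ := bondPercolation (zdGraph 2) half with hμ
  have hn : 1 ≤ n := le_trans hm hmn
  have hn0 : (0 : ℝ) < n := by exact_mod_cast hn
  have hm0 : (0 : ℝ) < m := by exact_mod_cast hm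
  have hmnpos : 0 < (m : ℝ) / n := by positivity
  have hRK₂ : K₂ * n ≤ R := le_trans (Nat.mul_le_mul_right n (le_max_left _ _)) hR
  have hRK₁ : K₁ * m ≤ R := le_trans (Nat.mul_le_mul (le_max_right K₂ K₁) hmn) hR
  have hnR : (n : ℝ) ≤ R := by
    have h1 : 1 * n ≤ max K₂ K₁ * n := Nat.mul_le_mul_right n (le_trans hK₂ (le_max_left _ _))
    exact_mod_cast (show n ≤ R by omega)
  have hR0 : (0 : ℝ) < R := lt_of_lt_of_le hn0 hnR
  have hreimer : μ.real (hpLooseArms j 3 m R) ≤ μ.real (hpLooseArms j 2 m R) * μ.real (hpLooseArm j m R) :=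
    (measureReal_mono (hpLooseArms_three_subset_disjointOccurrence j m R) (measure_ne_top _ _)).trans
      (reimer_holds (zdGraph 2) half ⟨_, determinedBy_hpLooseArms j 2 m R⟩ ⟨_, determinedBy_hpLooseArm j m R⟩)
  have h2 := htwo j m n R hm hmn hRK₂
  have h1 := hone j m R hm hRK₁
  have hmono : ((m : ℝ) / R) ^ α ≤ ((m : ℝ) / n) ^ α :=
    Real.rpow_le_rpow (by positivity) (div_le_div_of_nonneg_left hm0.le hn0 hnR) hα.le
  calc μ.real (hpLooseArms j 3 m R) ≤ μ.real (hpLooseArms j 2 m R) * μ.real (hpLooseArm j m R) := hreimer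
    _ ≤ (C₂ * m / n) * (C₁ * ((m : ℝ) / R) ^ α) :=
        mul_le_mul h2 h1 measureReal_nonneg (by positivity)
    _ ≤ (C₂ * m / n) * (C₁ * ((m : ℝ) / n) ^ α) :=
        mul_le_mul_of_nonneg_left (mul_le_mul_of_nonneg_left hmono hC₁.le) (by positivity)
    _ = C₂ * C₁ * ((m : ℝ) / n) ^ (1 + α) := by
        rw [Real.rpow_add hmnpos, Real.rpow_one]; ring

end

end Summit.CriticalPhenomena.CardyFormulaZ2.Cruxes.EdgePrecompact.QkzStripBoundaryArm
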